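import Summits.QuantumAdvantage.AdviceFreeQNC0.NearOutLemma
import Summits.QuantumAdvantage.AdviceFreeQNC0.LightMassK
import HarnessLib

/-!
# Cell qa-qnc0 (rung F-Q1, density axis, crux of record `TensorMultOneAt`): the near-outside lemma
# at EVERY LEVEL — `NearOutLemmaK m` for every `m` (planner qa-qnc0-p1 Sketch13 v6d, ask P18″)

`NearOutLemmaK m` (statement VERBATIM in qn-lit's `MassInequalityRegimes.lean`): for `k ≥ 1`, support
concentration at `K0`, outside determination, the outside dual words of the one-block code generated in
length `≤ L`, and `L·ρ <` (minimum non-zero weight of the `k`-block sum code `S_k`) give the mass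
inequality `bracketK m k K0 D ≥ 0` for every level-`(k+1)` deviation `D` (codeword columns in the last
block, `ColsInCK`) whose OUTSIDE rows lie within distance `ρ` of `S_k`.

Same proof as level one (`nearOutLemma`, `NearOutLemma.lean`) with the row code `C_m` replaced by
`S_k`: decode outside rows to nearest elements `c_u ∈ S_k`; short outside dual words `r` of the COLUMN
code give `Σ_{u∈r} c_u = Σ_{u∈r} e_u ∈ S_k` of weight `≤ Lρ`, hence `0`; span induction; puncturing
duality for the column code (`CodeDuality.mem_map_proj_of_orth` with `NearOut.codeSub`) extends each
decoded column `(c_u(v))_{u ∉ Z}` to a codeword `B_v ∈ C_m`; linear extension makes every row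
`v ↦ B_v(u)` a `ZMod 2`-combination of the `c_u`, hence an element of `S_k` (`NearOutK.xorSub`, the
sum code as a submodule); `D ⊕ B` has error rows outside and `S_k`-shifted rows inside, so the bracket
is `≥ Σ_out pwt − Σ_in pwt = Σ_v (|A_v ∖ Z| − |A_v ∩ Z|) ≥ 0` by `SC1At` (`LightK.sum_pwt_eq_sum_ctx`).

* **`nearOutLemmaK : ∀ m, NearOutLemmaK m`**.

The cell's lemma (not in print).  WHAT THIS IS NOT: the finite inputs (`DualGenOut m K0 6` at
`m = 14, 15`, `d(S_k) = d(C_m)`) are not here; the far regime of `MassIneqAll` is OPEN; nothing on α;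
separation NOT moved.
-/

noncomputable section

namespace Summit.QuantumAdvantage.AdviceFreeQNC0

open Finset
open MassInequality TensorLP CodeDuality NearOut LightK

namespace NearOutK

variable {n : ℕ}

/-- An `xor`-closed family of patterns containing `0`, as a `ZMod 2`-submodule of the functions on the cube
(indicators of its members). -/
def xorSub (S : ((Fin n → Bool) → Bool) → Prop) (h0 : S (fun _ => false))
    (hxor : ∀ Q Q', S Q → S Q' → S (fun v => xor (Q v) (Q' v))) :
    Submodule (ZMod 2) ((Fin n → Bool) → ZMod 2) where
  carrier := {f | ∃ X, S X ∧ f = fun u => ι (X u)}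
  zero_mem' := ⟨fun _ => false, h0, by funext u; rfl⟩
  add_mem' := by
    rintro f g ⟨X, hX, rfl⟩ ⟨Y, hY, rfl⟩
    exact ⟨fun u => xor (X u) (Y u), hxor _ _ hX hY, by funext u; simp only [Pi.add_apply, ι_xor]⟩
  smul_mem' := by
    rintro a f ⟨X, hX, rfl⟩
    rcases (by decide : ∀ a : ZMod 2, a = 0 ∨ a = 1) a with ha | ha
    · rw [ha, zero_smul]; exact ⟨fun _ => false, h0, by funext u; rfl⟩
    · rw [ha, one_smul]; exact ⟨X, hX, rfl⟩

/-- Members' indicators lie in `xorSub`. -/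
theorem ι_mem_xorSub {S : ((Fin n → Bool) → Bool) → Prop} {h0 : S (fun _ => false)}
    {hxor : ∀ Q Q', S Q → S Q' → S (fun v => xor (Q v) (Q' v))} {X : (Fin n → Bool) → Bool}
    (hX : S X) : (fun u => ι (X u)) ∈ xorSub S h0 hxor := ⟨X, hX, rfl⟩

/-- Elements of `xorSub` are indicators of members. -/
theorem exists_of_mem_xorSub {S : ((Fin n → Bool) → Bool) → Prop} {h0 : S (fun _ => false)}
    {hxor : ∀ Q Q', S Q → S Q' → S (fun v => xor (Q v) (Q' v))} {f : (Fin n → Bool) → ZMod 2}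
    (hf : f ∈ xorSub S h0 hxor) : ∃ X, S X ∧ ∀ u, f u = ι (X u) := by
  obtain ⟨X, hX, rfl⟩ := hf
  exact ⟨X, hX, fun u => rfl⟩

/-- `pwt (a ⊕ b) = pdist a b` (any cube). -/
theorem pwt_xor_eq_pdist' (a b : (Fin n → Bool) → Bool) : pwt (fun v => xor (a v) (b v)) = pdist a b := by
  unfold pwt pdist
  congr 1; ext v
  simp only [mem_filter, mem_univ, true_and]
  cases a v <;> cases b v <;> decide

/-- Weight of the indicator pattern of a `ZMod 2`-sum of indicators (rows on any cube). -/
theorem card_sum_eq_one_le' {m : ℕ} (F : Finset (Fin m → Bool)) (e : (Fin m → Bool) → (Fin n → Bool) → Bool) :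
    (univ.filter fun v : Fin n → Bool => (∑ u ∈ F, ι (e u v)) = 1).card ≤ ∑ u ∈ F, pwt (e u) := by
  classical
  calc (univ.filter fun v : Fin n → Bool => (∑ u ∈ F, ι (e u v)) = 1).card
      ≤ (F.biUnion fun u => univ.filter fun v : Fin n → Bool => e u v = true).card := by
        refine card_le_card fun v hv => ?_
        simp only [mem_filter, mem_univ, true_and, mem_biUnion] at hv ⊢
        by_contra h
        have h' : ∀ u ∈ F, e u v = false := fun u hu => by
          cases he : e u v
          · rfl
          · exact absurd ⟨u, hu, he⟩ h
        have : (∑ u ∈ F, ι (e u v)) = 0 :=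
          sum_eq_zero fun u hu => by rw [ι_eq_zero_iff]; exact h' u hu
        rw [this] at hv; exact zero_ne_one hv
    _ ≤ ∑ u ∈ F, (univ.filter fun v : Fin n → Bool => e u v = true).card := card_biUnion_le
    _ = ∑ u ∈ F, pwt (e u) := rfl

end NearOutK

open NearOutK

/-- **`NearOutLemmaK m` for every `m` — PROVED** (planner qa-qnc0-p1 Sketch13 v6d, ask P18″). -/
theorem nearOutLemmaK (m : ℕ) : NearOutLemmaK m := by
  classical
  intro K0 L ρ k _ hSC hOut hGen hmin D hcols hnear
  set S : ((Fin (m * k) → Bool) → Bool) → Prop := SumCodeWin (m * k) k 1 with hS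
  have hS0 : S (fun _ => false) := sumCode_false m k
  have hSxor : ∀ Q Q', S Q → S Q' → S (fun v => xor (Q v) (Q' v)) :=
    fun Q Q' hQ hQ' => TensorLP.sumCodeWin_xor hQ hQ'
  -- nearest sum-code elements of the outside rows (zero inside)
  have hc : ∀ u : Fin m → Bool, ∃ Q, S Q ∧ (K0 u = true → pdist (D u) Q = distTo S (D u)) ∧
      (K0 u = false → Q = fun _ => false) := by
    intro u
    by_cases hu : K0 u = true
    · obtain ⟨Q, hQ, hQd⟩ := exists_eq_distTo ⟨_, hS0⟩ (D u)
      exact ⟨Q, hQ, fun _ => hQd, fun h => by rw [h] at hu; exact absurd hu Bool.false_ne_true⟩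
    · exact ⟨fun _ => false, hS0, fun h => absurd h hu, fun _ => rfl⟩
  choose c hcE hcd hc0 using hc
  have hcin : ∀ u v, K0 u = false → c u v = false := fun u v hu => by rw [hc0 u hu]
  -- columns are codewords of the one-block code
  have hDcol : ∀ r, IsDualVec m r → ∀ v, ∑ u, r u * ι (D u v) = 0 := by
    intro r hr v
    have h := hr (fun u => D u v) (hcols v)
    have e : (∑ u, r u * ι (D u v)) = ∑ u : Fin m → Bool, (if D u v = true then r u else 0) :=
      sum_congr rfl fun u _ => by cases D u v <;> simp [ι]
    rw [e]; exact h
  -- generators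
  have hgen : ∀ r, IsDualVec m r → SuppOut K0 r → (univ.filter fun u : Fin m → Bool => r u ≠ 0).card ≤ L →
      ∀ v, ∑ u, r u * ι (c u v) = 0 := by
    intro r hr hs hL
    set F := univ.filter fun u : Fin m → Bool => r u ≠ 0 with hF
    have hr1 : ∀ u, r u ≠ 0 → r u = 1 := fun u h => by
      rcases (by decide : ∀ a : ZMod 2, a = 0 ∨ a = 1) (r u) with h' | h'
      · exact absurd h' h
      · exact h'
    have hsumF : ∀ g : (Fin m → Bool) → ZMod 2, ∑ u, r u * g u = ∑ u ∈ F, g u := by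
      intro g
      rw [← sum_filter_add_sum_filter_not univ (fun u => r u ≠ 0), ← hF]
      have h0 : ∑ u ∈ univ.filter (fun u : Fin m → Bool => ¬ r u ≠ 0), r u * g u = 0 :=
        sum_eq_zero fun u hu => by rw [not_not.1 (mem_filter.1 hu).2, zero_mul]
      rw [h0, add_zero]
      exact sum_congr rfl fun u hu => by rw [hr1 u (mem_filter.1 hu).2, one_mul]
    have hmem : (∑ u ∈ F, fun v => ι (c u v)) ∈ xorSub S hS0 hSxor :=
      Submodule.sum_mem _ fun u _ => ι_mem_xorSub (hcE u)
    obtain ⟨X, hX, hXv⟩ := exists_of_mem_xorSub hmem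
    have hXval : ∀ v, ι (X v) = ∑ u ∈ F, ι (c u v) := fun v => by rw [← hXv v, Finset.sum_apply]
    have hce : ∀ v, ∑ u ∈ F, ι (c u v) = ∑ u ∈ F, ι (xor (D u v) (c u v)) := by
      intro v
      have h1 : ∑ u ∈ F, ι (D u v) = 0 := by rw [← hsumF]; exact hDcol r hr v
      have h2 : ∑ u ∈ F, ι (xor (D u v) (c u v)) = ∑ u ∈ F, ι (D u v) + ∑ u ∈ F, ι (c u v) := by
        rw [← sum_add_distrib]; exact sum_congr rfl fun u _ => ι_xor _ _
      rw [h2, h1, zero_add]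
    have hwt : pwt X ≤ L * ρ := by
      calc pwt X = (univ.filter fun v : Fin (m * k) → Bool =>
            (∑ u ∈ F, ι (xor (D u v) (c u v))) = 1).card := by
            unfold pwt; congr 1; ext v
            simp only [mem_filter, mem_univ, true_and]
            rw [← hce, ← hXval, ι_eq_one_iff]
        _ ≤ ∑ u ∈ F, pwt (fun v => xor (D u v) (c u v)) := card_sum_eq_one_le' F _
        _ ≤ ∑ u ∈ F, ρ := sum_le_sum fun u hu => by
            have hu : K0 u = true := hs u (mem_filter.1 hu).2
            rw [pwt_xor_eq_pdist', hcd u hu]; exact hnear u hu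
        _ = F.card * ρ := by rw [sum_const, smul_eq_mul]
        _ ≤ L * ρ := Nat.mul_le_mul_right _ hL
    have hX0 : pwt X = 0 := by
      by_contra h
      have := hmin X hX h
      omega
    intro v
    rw [hsumF, ← hXval]
    have : X v = false := by
      unfold pwt at hX0
      rw [Finset.card_eq_zero, filter_eq_empty_iff] at hX0
      have := hX0 (mem_univ v)
      cases hq : X v
      · rfl
      · exact absurd hq this
    rw [this]; rfl
  -- all outside dual words
  have hall : ∀ r, IsDualVec m r → SuppOut K0 r → ∀ v, ∑ u, r u * ι (c u v) = 0 := by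
    intro r hr hs
    have hspan := hGen r hr hs
    refine Submodule.span_induction (p := fun r _ => ∀ v, ∑ u, r u * ι (c u v) = 0) ?_ ?_ ?_ ?_ hspan
    · rintro r' ⟨hr', hs', hL'⟩ v; exact hgen r' hr' hs' hL' v
    · intro v; simp
    · intro x y _ _ hx hy v
      simp only [Pi.add_apply, add_mul, sum_add_distrib, hx v, hy v, add_zero]
    · intro a x _ hx v
      simp only [Pi.smul_apply, smul_eq_mul, mul_assoc, ← mul_sum, hx v, mul_zero]
  -- puncturing duality for the COLUMN code `C_m`
  have hext : ∀ v, ∃ Bv, IsElim1 m Bv ∧ ∀ u, K0 u = true → Bv u = c u v := by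
    intro v
    have hy : (fun u => ι (c u v)) ∈ (codeSub m).map (proj fun u => K0 u = true) := by
      refine mem_map_proj_of_orth (codeSub m) (fun u => K0 u = true) _ (fun u hu => ?_) (fun r hr0 hrC => ?_)
      · rw [ι_eq_zero_iff]; exact hcin u v (by simpa using hu)
      · have hdual : IsDualVec m r := by
          intro A hA
          have h := hrC _ (ι_mem_codeSub hA)
          rw [dotForm_apply] at h
          have e : (∑ u : Fin m → Bool, (if A u = true then r u else 0)) = ∑ u, r u * ι (A u) :=
            sum_congr rfl fun u _ => by cases A u <;> simp [ι]
          rw [e]; exact h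
        have hsupp : SuppOut K0 r := fun u hu => by
          by_contra h; exact hu (hr0 u h)
        rw [dotForm_apply]
        exact hall r hdual hsupp v
    obtain ⟨f, hf, hfy⟩ := Submodule.mem_map.1 hy
    obtain ⟨Bv, hBv, hfB⟩ := exists_of_mem_codeSub hf
    refine ⟨Bv, hBv, fun u hu => ?_⟩
    have h := congrFun hfy u
    simp only [proj_apply, hu, if_true, hfB] at h
    exact ι_injective h
  choose B hB hBout using hext
  -- linear extension: rows of `B` lie in `S_k`
  have hinj : ∀ f ∈ codeSub m, proj (fun u => K0 u = true) f = 0 → f = 0 := by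
    intro f hf hf0
    obtain ⟨A, hA, hfA⟩ := exists_of_mem_codeSub hf
    have hAout : ∀ u, K0 u = true → A u = false := fun u hu => by
      have h := congrFun hf0 u
      simp only [proj_apply, hu, if_true, Pi.zero_apply, hfA] at h
      exact (ι_eq_zero_iff _).1 h
    funext u
    rw [hfA, Pi.zero_apply, ι_eq_zero_iff]
    exact hOut A hA hAout u
  have hrow : ∀ u₀, S (fun v => B v u₀) := by
    intro u₀
    obtain ⟨lam, hlam⟩ := exists_coeffs_of_injOn (codeSub m) (fun u => K0 u = true) hinj u₀
    have hmem : (∑ u, lam u • fun v => ι (c u v)) ∈ xorSub S hS0 hSxor :=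
      Submodule.sum_mem _ fun u _ => Submodule.smul_mem _ _ (ι_mem_xorSub (hcE u))
    obtain ⟨R, hR, hRv⟩ := exists_of_mem_xorSub hmem
    have hval : ∀ v, ι (B v u₀) = ι (R v) := by
      intro v
      rw [← hRv v, hlam _ (ι_mem_codeSub (hB v))]
      simp only [Finset.sum_apply, Pi.smul_apply, smul_eq_mul, proj_apply]
      refine sum_congr rfl fun u _ => ?_
      by_cases hu : K0 u = true
      · rw [if_pos hu, hBout v u hu]
      · rw [if_neg hu, hcin u v (by simpa using hu)]; simp [ι]
    have : (fun v => B v u₀) = R := funext fun v => ι_injective (hval v)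
    rw [this]; exact hR
  -- the corrected deviation
  set D' : (Fin m → Bool) → (Fin (m * k) → Bool) → Bool := fun u v => xor (D u v) (B v u) with hD'
  have hcols' : ColsInCK m k D' := fun v => isElim1_xor (hcols v) (hB v)
  have hout_eq : ∀ u, K0 u = true → (distTo S (D u) : ℤ) = pwt (D' u) := by
    intro u hu
    have e1 : (fun v => D' u v) = fun v => xor (D u v) (c u v) := funext fun v => by
      show xor (D u v) (B v u) = xor (D u v) (c u v); rw [hBout v u hu]
    rw [show pwt (D' u) = pwt (fun v => D' u v) from rfl, e1, pwt_xor_eq_pdist', hcd u hu]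
  have hin_le : ∀ u, (distTo S (D u) : ℤ) ≤ pwt (D' u) := by
    intro u
    rw [show pwt (D' u) = pwt (fun v => xor (D u v) (B v u)) from rfl, pwt_xor_eq_pdist']
    exact_mod_cast distTo_le (hrow u)
  -- bracket ≥ outside weights − inside weights ≥ 0 by SC₁ columnwise
  unfold bracketK
  have h1 : ∑ u ∈ univ.filter (fun u : Fin m → Bool => K0 u = true), (distTo S (D u) : ℤ) =
      ∑ u ∈ univ.filter (fun u : Fin m → Bool => K0 u = true), (pwt (D' u) : ℤ) :=
    sum_congr rfl fun u hu => hout_eq u (mem_filter.1 hu).2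
  have h2 : ∑ u ∈ univ.filter (fun u : Fin m → Bool => K0 u = false), (distTo S (D u) : ℤ) ≤
      ∑ u ∈ univ.filter (fun u : Fin m → Bool => K0 u = false), (pwt (D' u) : ℤ) :=
    sum_le_sum fun u _ => hin_le u
  have h3 : ∑ u ∈ univ.filter (fun u : Fin m → Bool => K0 u = false), (pwt (D' u) : ℤ) ≤
      ∑ u ∈ univ.filter (fun u : Fin m → Bool => K0 u = true), (pwt (D' u) : ℤ) := by
    rw [← Nat.cast_sum, ← Nat.cast_sum, Nat.cast_le, sum_pwt_eq_sum_ctx K0 D' false,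
      sum_pwt_eq_sum_ctx K0 D' true]
    exact sum_le_sum fun v _ => hSC (fun u => D' u v) (hcols' v)
  rw [h1]
  linarith

end Summit.QuantumAdvantage.AdviceFreeQNC0
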